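import Summits.QuantumFields.YangMills.Theorems.UnitScaleTiltProp7KinvOneFamilyPackageAllMembers
import Summits.QuantumFields.YangMills.Theorems.UnitScaleTiltProp7H1OneFamilyPackage
import HarnessLib

/-!
# (R-EDITION, ROOM-FREE: K6-H1 `…H1OneFamilyPackage` §2 re-run over the `_allMembers` inputs — K6-Δ₁-R `kinvRow_one_family_exists_allMembers`, GJ-R `hGblk_one_family_exists_allMembers` conj 1,
# T3-R `hco_DeltaOnePJ_exists_allMembers`; the no-wrap ROOM antecedent is GONE and the thread is `Lift` alone — px10's K6-h133-R token pattern; §1 (the slot-generic H-door) is IMPORTED.)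
# Route `UnitScaleTilt`, crux K1 «MinimiserStabilityRegPr» (stmt-QuantumFields-19200), EX row (6) `norm_H₁` VALUE side — FILE (K6-H1-R):
# **THE POINTWISE KERNEL OF `H₁` AT `Δ₁ᴾ(T_Jᴾ)` FOR ALL MEMBERS, ROOM-FREE, AS ONE `∃`-PACKAGE**

Cell `ym3-torus` (HUMAN RULING D-0037; rung R3 = SU(2) YM₃ on T³ — NOT d = 4, NOT infinite volume, NOT a mass gap, NOT Clay).  Width seat `ym3-torus-px12` (gen 18).
THEOREMS ONLY (0 `def`, 0 `sorry`, default heartbeats); `--supports stmt-QuantumFields-19200 --as helper`; count-neutral.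

WHAT IS PROVED (ns `Summit.QuantumFields.YangMills.Theorems.Prop7H1OneFamilyPackageAllMembers`).
* ★★★ `hH1kernel_family_exists_allMembers` — `∃ αH CH δH` (caps∕signs) with, for every member under `RegPr ρ U₀ → ρ ≤ αH L → Lift → a ∈ [a₀,a₁]·(c₀ L∕cB L)ℓ³` (NO ROOM):
  `‖flat115 ((H1f … a (DeltaOneP … a (TJSlotP … a)) U₀) (Pi.single y Z)) b′‖ ≤ CH L·e^{−(δH L∕2)·tdist}·‖Z‖`.
THE ONE DISPLAYED LETTER.  px19's gauge-spike Hessian row family `hqG`.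
HONEST SCOPE.  An `∃`-assembly; no estimate of print is proved HERE; nothing of `hqG`, `norm_H₁`'s gradient half, EX or the crux is proved; the Yang–Mills mass gap is NOT proved.

References: T. Bałaban, CMP **99** (1985) 389–434 [Balaban1985BackgroundPropagators] ((3.133) p.422, Thm 3.12 p.423, (3.126)–(3.128) pp.420–421); CMP **102** (1985) 277–309
[Balaban1985Variational] ((103) p.293, (45)–(46) p.285).
-/

set_option autoImplicit false

noncomputable section

open scoped BigOperators Matrix.Norms.L2Operator InnerProductSpace ComplexConjugate

namespace Summit.QuantumFields.YangMills.Theorems.Prop7H1OneFamilyPackageAllMembers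

open Literature.MathematicalPhysics.QuantumFieldTheory.Balaban1983to89
open Literature.MathematicalPhysics.QuantumFieldTheory.Balaban1983to89.T3ContinuumYM3Torus
open Literature.MathematicalPhysics.QuantumFieldTheory.Balaban1983to89.T3Thm1Carrier
open T3PrintedRegularMinimiser (RegPr)
open T3PrintedMinimiserExistence (regPr_mono)
open T3PrintedRegularOrbits (sites_eq)
open T3LevelShift (siteShift)
open T3SectALandauChart (bgUnits)
open B15DeterminingSets (embIter)
open B9SectCLatticeCarrier (Bond)
open B9Eq311L2Pairing (WL2)
open B11Eq103H1Complex (BondL2K)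
open B11Eq90V0primeCurrent (flat115)
open B5Eq118OneStroke (iterBlockOf)
open Summit.QuantumFields.YangMills.Theorems.Prop8Chart (emlIterU)
open Summit.QuantumFields.YangMills.Theorems.Prop7SectET3Transport (periodsT3 bondEquiv)
open Summit.QuantumFields.YangMills.Theorems.Prop7SectET3HilbertLetters (W₂ toL2 toL2B)
open Summit.QuantumFields.YangMills.Theorems.Prop7SectET3CurvedPropagators (Qk GT KinvT H1f PosOnto)
open Summit.QuantumFields.YangMills.Theorems.Prop7SectET3HilbertLetters (toL2S DL2)
open Summit.QuantumFields.YangMills.Theorems.Prop7SectET3DeltaOne (avgHess)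
open Summit.QuantumFields.YangMills.Theorems.Prop7SectET3DeltaOnePInv (DeltaOneP TJSlotP)
open Summit.QuantumFields.YangMills.Theorems.Prop7TJSlotCoerciveClosedAllMembers (hco_DeltaOnePJ_exists_allMembers)
open Summit.QuantumFields.YangMills.Theorems.Prop7H1OneFamilyPackage (kernelH_family_of_kinvRow_of_greenBlockSup_slot)
open Summit.QuantumFields.YangMills.Theorems.Prop7Kernel133OfPiBlockLetters (blockLetter_mono_rate coarseRow_mono_rate)
open Summit.QuantumFields.YangMills.Theorems.Prop7KinvOneFamilyPackageAllMembers (kinvRow_one_family_exists_allMembers)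
open Summit.QuantumFields.YangMills.Theorems.Prop7GreenOneBlockFamilyPackageAllMembers (hGblk_one_family_exists_allMembers)

/-- ★★★ **THE KERNEL ROW OF `H₁` AT `Δ₁ᴾ(T_Jᴾ)` FOR ALL MEMBERS, ROOM-FREE, AS ONE `∃`-PACKAGE** (cap `αH`, constant `CH L`, rate `δH L∕2`; thread `Lift ∧` coupling window; `hqG`
DISPLAYED) — the slot-generic H-door at `Δx L i := DeltaOneP … (a L i) (TJSlotP … (a L i))` ∘ {K6-Δ₁-R, GJ-R conj 1, T3-R `PosOnto`(Δ₁ᴾ)}.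
[cite: Balaban1985BackgroundPropagators, (3.133) p.422, Thm 3.12 p.423, (3.127)–(3.128) p.421; Balaban1985Variational, (103) p.293] -/
theorem hH1kernel_family_exists_allMembers [hFL : ∀ F : T3Family, Fact (0 < (F.L : ℝ))] [hFη : ∀ (F : T3Family) (k : ℕ), Fact (0 < ((F.L : ℝ)⁻¹) ^ k)]
    (c₀ cB : ℕ → ℝ) [hc₀ : ∀ L : ℕ, Fact (0 < c₀ L)] [hcB : ∀ L : ℕ, Fact (0 < cB L)] {a₀ a₁ : ℝ} (ha₀ : 0 < a₀) (ha₀₁ : a₀ ≤ a₁)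
    (αq qG : ℕ → ℝ) (hαq : ∀ L : ℕ, 1 < L → 0 < αq L) (hqG : ∀ L : ℕ, 1 < L → 0 ≤ qG L)
    (hqGrow : ∀ (L : ℕ), 1 < L → ∀ (i : Idx L) (U₀ : GaugeField (i.1.1.P i.1.2.2) 0 (Matrix.specialUnitaryGroup (Fin 2) ℂ)), RegPr i.1.1 i.1.2.1 i.1.2.2 (αq L) U₀ →
      ∀ (X' : PBond (i.1.1.P i.1.2.2) 0 → Matrix (Fin 2) (Fin 2) ℂ) (s : ℝ) (x : Site (i.1.1.P i.1.2.2) 0) (A : Matrix (Fin 2) (Fin 2) ℂ), (∀ b, ‖X' b‖ ≤ s) →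
        ∑ y : PBond (i.1.1.P i.1.2.1) 0, ‖avgHess i.1.1 i.1.2.1 i.1.2.2 i.2.2.le U₀ X'
            ((toL2 i.1.1 i.1.2.2 (c₀ L)).symm (DL2 i.1.1 i.1.2.1 i.1.2.2 (c₀ L) U₀ (toL2S i.1.1 i.1.2.2 (c₀ L) (Pi.single x A)))) y‖
          ≤ qG L * ((L : ℝ) ^ (i.1.2.2 - i.1.2.1))⁻¹ * s * ‖A‖) :
    ∃ (αH CH δH : ℕ → ℝ),
      (∀ L : ℕ, 1 < L → 0 < αH L) ∧ (∀ L : ℕ, 1 < L → 10 ^ 12 * (L : ℝ) ^ 3 * αH L ≤ 1) ∧ (∀ L : ℕ, 1 < L → 10 ^ 10 * (L : ℝ) ^ 6 * αH L ≤ 1) ∧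
      (∀ L : ℕ, 1 < L → 13 * 10 ^ 14 * (L : ℝ) ^ 3 * αH L ≤ 1) ∧ (∀ L : ℕ, 1 < L → αH L ≤ 1) ∧ (∀ L : ℕ, 1 < L → 0 ≤ CH L) ∧ (∀ L : ℕ, 1 < L → 0 < δH L) ∧
    ∀ (L : ℕ), 1 < L → ∀ (i : Idx L) (U₀ : GaugeField (i.1.1.P i.1.2.2) 0 (Matrix.specialUnitaryGroup (Fin 2) ℂ)), ∀ ρ : ℝ, RegPr i.1.1 i.1.2.1 i.1.2.2 ρ U₀ → ρ ≤ αH L →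
        (∀ cf : Site (i.1.1.P i.1.2.2) (i.1.2.2 - i.1.2.1) → Matrix (Fin 2) (Fin 2) ℂ,
        (∀ e' : PBond (i.1.1.P i.1.2.2) (i.1.2.2 - i.1.2.1), cf e'.src = ((emlIterU (i.1.2.2 - i.1.2.1) (bgUnits i.1.1 i.1.2.2 U₀) e' : (Matrix (Fin 2) (Fin 2) ℂ)ˣ) : Matrix (Fin 2) (Fin 2) ℂ) * cf e'.tgt *
        (((emlIterU (i.1.2.2 - i.1.2.1) (bgUnits i.1.1 i.1.2.2 U₀) e')⁻¹ : (Matrix (Fin 2) (Fin 2) ℂ)ˣ) : Matrix (Fin 2) (Fin 2) ℂ)) →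
        ∃ l₀ : Site (i.1.1.P i.1.2.2) 0 → Matrix (Fin 2) (Fin 2) ℂ,
        (∀ b' : PBond (i.1.1.P i.1.2.2) 0, l₀ b'.src = ((bgUnits i.1.1 i.1.2.2 U₀ b' : (Matrix (Fin 2) (Fin 2) ℂ)ˣ) : Matrix (Fin 2) (Fin 2) ℂ) * l₀ b'.tgt * (((bgUnits i.1.1 i.1.2.2 U₀ b')⁻¹ : (Matrix (Fin 2) (Fin 2) ℂ)ˣ) : Matrix (Fin 2) (Fin 2) ℂ)) ∧
        ∀ y : Site (i.1.1.P i.1.2.2) (i.1.2.2 - i.1.2.1), l₀ (embIter (i.1.2.2 - i.1.2.1) y) = cf y) →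
      ∀ a : ℝ, a₀ * (c₀ L / cB L) * ((i.1.1.L : ℝ) ^ (i.1.2.2 - i.1.2.1)) ^ 3 ≤ a → a ≤ a₁ * (c₀ L / cB L) * ((i.1.1.L : ℝ) ^ (i.1.2.2 - i.1.2.1)) ^ 3 →
      ∀ (y : PBond (i.1.1.P i.1.2.1) 0) (Z : Matrix (Fin 2) (Fin 2) ℂ) (b' : Bond 3 (periodsT3 i.1.1 i.1.2.2)),
        ‖flat115 ((H1f i.1.1 i.1.2.1 i.1.2.2 i.2.2.le (c₀ L) (cB L) a (DeltaOneP i.1.1 i.1.2.1 i.1.2.2 i.2.2.le (c₀ L) (cB L) a (TJSlotP i.1.1 i.1.2.1 i.1.2.2 i.2.2.le (c₀ L) (cB L) a)) U₀) (Pi.single y Z)) b'‖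
          ≤ CH L * Real.exp (-(δH L / 2 * (Site.tdist (B5Eq118OneStroke.iterBlockOf (i.1.2.2 - i.1.2.1) ((bondEquiv i.1.1 i.1.2.2).symm b').src)
              (T3LevelShift.siteShift (T3PrintedRegularOrbits.sites_eq i.1.1 i.1.2.1 i.1.2.2 i.2.2.le) y.src) : ℝ))) * ‖Z‖ := by
  classical
  obtain ⟨αPi, CPi, μPi, hαPi, hWPi12, hWPi10, hWPi13, hαPi1, hCPi, hμPi, hKπ⟩ := kinvRow_one_family_exists_allMembers c₀ cB ha₀ ha₀₁ αq qG hαq hqG hqGrow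
  obtain ⟨αP, CP, KP, δP, hαP, hWP12, hWP10, hWP13, -, hCP, hKP, hδP, hP⟩ := hGblk_one_family_exists_allMembers c₀ cB ha₀ ha₀₁ αq qG hαq hqG hqGrow
  obtain ⟨αcp, γcp, hαcp, -, -, -, hcp⟩ := hco_DeltaOnePJ_exists_allMembers c₀ cB ha₀ ha₀₁
  set δ : ℕ → ℝ := fun L => min (μPi L) (δP L) with hδd
  have hδ0 : ∀ L : ℕ, 1 < L → 0 < δ L := fun L hL => by simp only [hδd]; exact lt_min (hμPi L hL) (hδP L hL)
  have hδμ : ∀ L : ℕ, δ L ≤ μPi L := fun L => min_le_left _ _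
  have hδP' : ∀ L : ℕ, δ L ≤ δP L := fun L => min_le_right _ _
  set αH : ℕ → ℝ := fun L => min (min (αPi L) (αP L)) (αcp L) with hαH
  have hαH0 : ∀ L : ℕ, 1 < L → 0 < αH L := fun L hL => by
    have := hαPi L hL; have := hαP L hL; have := hαcp L hL
    simp only [hαH]; exact lt_min (lt_min (by assumption) (by assumption)) (by assumption)
  have hαHPi : ∀ L, αH L ≤ αPi L := fun L => by simp only [hαH]; exact (min_le_left _ _).trans (min_le_left _ _)
  have hαHP : ∀ L, αH L ≤ αP L := fun L => by simp only [hαH]; exact (min_le_left _ _).trans (min_le_right _ _)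
  have hαHcp : ∀ L, αH L ≤ αcp L := fun L => by simp only [hαH]; exact min_le_right _ _
  have hW12 : ∀ L : ℕ, 1 < L → 10 ^ 12 * (L : ℝ) ^ 3 * αH L ≤ 1 := fun L hL => by
    have hL0 : (0 : ℝ) < L := by exact_mod_cast lt_trans zero_lt_one hL
    exact (mul_le_mul_of_nonneg_left (hαHPi L) (by positivity)).trans (hWPi12 L hL)
  have hW10 : ∀ L : ℕ, 1 < L → 10 ^ 10 * (L : ℝ) ^ 6 * αH L ≤ 1 := fun L hL => by
    have hL0 : (0 : ℝ) < L := by exact_mod_cast lt_trans zero_lt_one hL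
    exact (mul_le_mul_of_nonneg_left (hαHPi L) (by positivity)).trans (hWPi10 L hL)
  have hW13 : ∀ L : ℕ, 1 < L → 13 * 10 ^ 14 * (L : ℝ) ^ 3 * αH L ≤ 1 := fun L hL => by
    have hL0 : (0 : ℝ) < L := by exact_mod_cast lt_trans zero_lt_one hL
    exact (mul_le_mul_of_nonneg_left (hαHPi L) (by positivity)).trans (hWPi13 L hL)
  refine ⟨αH, fun L => 1920 * Real.exp (δ L + 1) * CPi L * CP L * (2 * (1 + 2 / δ L)) ^ 3, δ, hαH0, hW12, hW10, hW13,
    fun L hL => (hαHPi L).trans (hαPi1 L hL), fun L hL => by have := hCPi L hL; have := hCP L hL; have := hδ0 L hL; positivity, hδ0, ?_⟩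
  intro L hL i U₀ ρ hreg hρ hlift a ha₀a ha₁a y Z b'
  -- the clamped coupling function
  obtain ⟨af, haf⟩ : ∃ f : ∀ L' : ℕ, Idx L' → ℝ, ∀ (L' : ℕ) (i' : Idx L'),
      f L' i' = max (a₀ * (c₀ L' / cB L') * ((i'.1.1.L : ℝ) ^ (i'.1.2.2 - i'.1.2.1)) ^ 3) (min a (a₁ * (c₀ L' / cB L') * ((i'.1.1.L : ℝ) ^ (i'.1.2.2 - i'.1.2.1)) ^ 3)) :=
    ⟨_, fun _ _ => rfl⟩
  have ht0 : ∀ (L' : ℕ) (i' : Idx L'), 0 ≤ (c₀ L' / cB L') * ((i'.1.1.L : ℝ) ^ (i'.1.2.2 - i'.1.2.1)) ^ 3 := fun L' i' =>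
    mul_nonneg (div_nonneg (hc₀ L').out.le (hcB L').out.le) (pow_nonneg (pow_nonneg (Nat.cast_nonneg _) _) _)
  have haf_lo : ∀ (L' : ℕ) (i' : Idx L'), a₀ * (c₀ L' / cB L') * ((i'.1.1.L : ℝ) ^ (i'.1.2.2 - i'.1.2.1)) ^ 3 ≤ af L' i' := fun L' i' => by rw [haf]; exact le_max_left _ _
  have haf_hi : ∀ (L' : ℕ) (i' : Idx L'), af L' i' ≤ a₁ * (c₀ L' / cB L') * ((i'.1.1.L : ℝ) ^ (i'.1.2.2 - i'.1.2.1)) ^ 3 := fun L' i' => by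
    rw [haf]
    refine max_le ?_ (min_le_right _ _)
    have := ht0 L' i'
    rw [mul_assoc, mul_assoc]; exact mul_le_mul_of_nonneg_right ha₀₁ this
  have hafa : af L i = a := by rw [haf, min_eq_left ha₁a, max_eq_right ha₀a]
  -- the thread `Lift`
  obtain ⟨Λ, hΛ⟩ : ∃ Λ : ∀ (L' : ℕ) (i' : Idx L'), GaugeField (i'.1.1.P i'.1.2.2) 0 (Matrix.specialUnitaryGroup (Fin 2) ℂ) → Prop, ∀ L' i' U₀', Λ L' i' U₀' ↔
      ((∀ cf : Site (i'.1.1.P i'.1.2.2) (i'.1.2.2 - i'.1.2.1) → Matrix (Fin 2) (Fin 2) ℂ,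
        (∀ e' : PBond (i'.1.1.P i'.1.2.2) (i'.1.2.2 - i'.1.2.1), cf e'.src = ((emlIterU (i'.1.2.2 - i'.1.2.1) (bgUnits i'.1.1 i'.1.2.2 U₀') e' : (Matrix (Fin 2) (Fin 2) ℂ)ˣ) : Matrix (Fin 2) (Fin 2) ℂ) * cf e'.tgt *
        (((emlIterU (i'.1.2.2 - i'.1.2.1) (bgUnits i'.1.1 i'.1.2.2 U₀') e')⁻¹ : (Matrix (Fin 2) (Fin 2) ℂ)ˣ) : Matrix (Fin 2) (Fin 2) ℂ)) →
        ∃ l₀ : Site (i'.1.1.P i'.1.2.2) 0 → Matrix (Fin 2) (Fin 2) ℂ,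
        (∀ b' : PBond (i'.1.1.P i'.1.2.2) 0, l₀ b'.src = ((bgUnits i'.1.1 i'.1.2.2 U₀' b' : (Matrix (Fin 2) (Fin 2) ℂ)ˣ) : Matrix (Fin 2) (Fin 2) ℂ) * l₀ b'.tgt * (((bgUnits i'.1.1 i'.1.2.2 U₀' b')⁻¹ : (Matrix (Fin 2) (Fin 2) ℂ)ˣ) : Matrix (Fin 2) (Fin 2) ℂ)) ∧
        ∀ y : Site (i'.1.1.P i'.1.2.2) (i'.1.2.2 - i'.1.2.1), l₀ (embIter (i'.1.2.2 - i'.1.2.1) y) = cf y)) := ⟨_, fun _ _ _ => Iff.rfl⟩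
  -- the H-door
  have key := kernelH_family_of_kinvRow_of_greenBlockSup_slot αH hαH0 hW10 hW12 c₀ cB af
    (fun L' i' => DeltaOneP i'.1.1 i'.1.2.1 i'.1.2.2 i'.2.2.le (c₀ L') (cB L') (af L' i') (TJSlotP i'.1.1 i'.1.2.1 i'.1.2.2 i'.2.2.le (c₀ L') (cB L') (af L' i'))) Λ
    (fun L' hL' i' U₀' ρ' hreg' hρ' hl' =>
      (hcp L' hL' i' U₀' ρ' hreg' (hρ'.trans (hαHcp L')) ((hΛ L' i' U₀').mp hl') (af L' i') (haf_lo L' i') (haf_hi L' i')).2.1)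
    CPi CP δ hCPi hCP hδ0
    (fun L' hL' i' U₀' ρ' hreg' hρ' hl' => coarseRow_mono_rate i'.2.2.le (cB L') _
      (mul_nonneg (hCPi L' hL') (by have hL0 : (0 : ℝ) < L' := Nat.cast_pos.mpr (lt_trans zero_lt_one hL'); have := (hc₀ L').out; have := (hcB L').out; positivity)) (hδμ L')
      (hKπ L' hL' i' U₀' ρ' hreg' (hρ'.trans (hαHPi L')) ((hΛ L' i' U₀').mp hl') (af L' i') (haf_lo L' i') (haf_hi L' i')))
    (fun L' hL' i' U₀' ρ' hreg' hρ' hl' =>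
      blockLetter_mono_rate (fun b : PBond (i'.1.1.P i'.1.2.2) 0 => iterBlockOf (i'.1.2.2 - i'.1.2.1) b.src) (fun bd : PBond (i'.1.1.P i'.1.2.2) 0 => iterBlockOf (i'.1.2.2 - i'.1.2.1) bd.src)
        (fun X bd => (toL2 i'.1.1 i'.1.2.2 (c₀ L')).symm (GT i'.1.1 i'.1.2.1 i'.1.2.2 i'.2.2.le (c₀ L') (cB L') (af L' i')
          (DeltaOneP i'.1.1 i'.1.2.1 i'.1.2.2 i'.2.2.le (c₀ L') (cB L') (af L' i') (TJSlotP i'.1.1 i'.1.2.1 i'.1.2.2 i'.2.2.le (c₀ L') (cB L') (af L' i'))) U₀' (toL2 i'.1.1 i'.1.2.2 (c₀ L') X)) bd) (hCP L' hL') (hδP' L')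
        (hP L' hL' i' U₀' ρ' hreg' (hρ'.trans (hαHP L')) ((hΛ L' i' U₀').mp hl') (af L' i') (haf_lo L' i') (haf_hi L' i')).1)
    L hL i U₀ ρ hreg hρ ((hΛ L i U₀).mpr hlift) y Z b'
  rw [hafa] at key
  exact key

end Summit.QuantumFields.YangMills.Theorems.Prop7H1OneFamilyPackageAllMembers

end
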